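import Summits.RiemannHypothesis.RiemannHypothesis.Theorems.TiltedLandingLaw421R3LightPairDrop
import Summits.RiemannHypothesis.RiemannHypothesis.Theorems.TiltedLandingLaw421R3BudgetCaseA

/-!
# K-2 budget: the CORNER CELL made explicit, and `GeometricBudget 10 μ₀` reduced to `t_v < 3/2` (C1 g35, W-08 ⟨33346⟩; answers (CA702)(B))

§1 `slack0 v z := T_v + T_z − 3 = −1 − 2·Im v·pairPull v z − 2·Im z·pairPull z v` — the ZEROTH-ORDER SLACK of the pair (image D: `≥ 0` on a touching
pair, `= 0` exactly at the side-touching equal corner `Im z = Im v`, `|Re v − Re z| = Im v + Im z`, which `GeometricBudget` approaches but never contains);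
the CORNER CELL of width `η` is `slack0 v z < η` (C1 target scan: outside `slack0 ≥ 1/4` the λ-uniform first-order margin is `≥ 10.6`, inside it falls
to `3.90` at the corner — crit-1 l.8312: the budget is TIGHT there and the second-order remainder constant is load-bearing THERE and nowhere else).
§2 `GeometricBudgetOn P C μ₀` = `GeometricBudget` with a side condition `P v z Kv Kz` prepended; the budget is the conjunction of its restrictions to
`P` and `¬P` (`geometricBudget_of_split`), in particular CORNER CELL ∧ BULK (`geometricBudget_of_corner_bulk`).  §3 with image J: for `μ₀ ≤ 1/2`,
**`GeometricBudget 10 μ₀` follows from its restriction to `−Im v·Im K_v < 3/2`** (`geometricBudget_ten_of_tv_lt`), and hence from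
(corner cell ∧ t_v < 3/2) ∧ (bulk ∧ t_v < 3/2) (`geometricBudget_ten_of_corner_bulk_tv_lt`) — the two boxes instr-1's E2 certifies, corner first.
STATUS: reductions only; `GeometricBudget 10 (1/2)` is NOT proved.  Nothing here bears on the truth of RH; RH is not proved; 33346 / 33347 OPEN. -/

namespace RhW08.BudgetCornerSplit

open Complex
open scoped ComplexConjugate
open RhW08.UncoveredSign (pairPull)
open RhW08.LightPairDrop (GeometricBudget)
open RhW08.BudgetCaseA (budget_caseA)

/-! ## §1 The zeroth-order slack and the corner cell -/

/-- §1 the ZEROTH-ORDER SLACK `S(v,z) = T_v + T_z − 3 = −1 − 2·Im v·pairPull v z − 2·Im z·pairPull z v` (`T_w = 1 − 2·Im w·pairPull w p`). -/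
noncomputable def slack0 (v z : ℂ) : ℝ := -1 - 2 * v.im * pairPull v z - 2 * z.im * pairPull z v

/-- §1 `S ≥ 0` on a touching pair (image D `leading_ge_three_of_touch`). -/
theorem slack0_nonneg_of_touch {v z : ℂ} (hab : 0 < v.im + z.im) (ht : |v.re - z.re| ≤ v.im + z.im) : 0 ≤ slack0 v z := by
  have h := RhW08.PairSign.leading_ge_three_of_touch hab ht
  rw [slack0]; linarith

/-- §1 the CORNER CELL of width `η`: `S(v,z) < η` (the neighbourhood of the side-touching equal corner in the pair's own coordinates). -/
def CornerCell (η : ℝ) (v z : ℂ) : Prop := slack0 v z < η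

/-! ## §2 Restricted budgets and the split -/

/-- §2 `GeometricBudget C μ₀` WITH A SIDE CONDITION `P v z K_v K_z` prepended (binders otherwise verbatim). -/
def GeometricBudgetOn (P : ℂ → ℂ → ℂ → ℂ → Prop) (C μ₀ : ℝ) : Prop :=
  ∀ (v z Rv Rz Kv Kz u₁ u₂ : ℂ) (M : ℝ), P v z Kv Kz →
    0 < v.im → v.im < z.im → |v.re - z.re| ≤ v.im + z.im → v.im ≤ 2 * ‖v - z‖ → 0 ≤ M → M ≤ μ₀ →
    Kv = (v - conj v)⁻¹ + (v - z)⁻¹ + (v - conj z)⁻¹ + Rv → Kz = (z - conj z)⁻¹ + (z - v)⁻¹ + (z - conj v)⁻¹ + Rz →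
    Rv.im ≤ 0 → Rz.im ≤ 0 → ‖Rz - Rv‖ ≤ M * ‖z - v‖ / (v.im * z.im) →
    30 ≤ v.im * ‖Kv + I / (2 * (v.im : ℂ))‖ → 30 ≤ z.im * ‖Kz + I / (2 * (z.im : ℂ))‖ →
    ‖u₁ - (v - Kv⁻¹)‖ ≤ (9 / 5) * (μ₀ / (v.im * ‖Kv‖) ^ 2) / ‖Kv‖ → ‖u₂ - (z - Kz⁻¹)‖ ≤ (9 / 5) * (μ₀ / (z.im * ‖Kz‖) ^ 2) / ‖Kz‖ →
    3 - C * (1 + μ₀) / (v.im * ‖Kv + I / (2 * (v.im : ℂ))‖) ≤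
      ((v.im ^ 2 + z.im ^ 2) - (u₁.im ^ 2 + u₂.im ^ 2)) * ‖Kv + I / (2 * (v.im : ℂ))‖ ^ 2

/-- §2 the unrestricted budget is the `True`-restricted one. -/
theorem geometricBudget_iff_on_true (C μ₀ : ℝ) : GeometricBudget C μ₀ ↔ GeometricBudgetOn (fun _ _ _ _ => True) C μ₀ :=
  ⟨fun h v z Rv Rz Kv Kz u₁ u₂ M _ => h v z Rv Rz Kv Kz u₁ u₂ M, fun h v z Rv Rz Kv Kz u₁ u₂ M => h v z Rv Rz Kv Kz u₁ u₂ M trivial⟩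

/-- §2 restriction is antitone in the side condition. -/
theorem geometricBudgetOn_mono {P Q : ℂ → ℂ → ℂ → ℂ → Prop} {C μ₀ : ℝ} (hPQ : ∀ v z Kv Kz, P v z Kv Kz → Q v z Kv Kz)
    (h : GeometricBudgetOn Q C μ₀) : GeometricBudgetOn P C μ₀ :=
  fun v z Rv Rz Kv Kz u₁ u₂ M hP => h v z Rv Rz Kv Kz u₁ u₂ M (hPQ v z Kv Kz hP)

/-- §2 THE SPLIT: the budget on `P` and on `¬P` give the budget. -/
theorem geometricBudget_of_split {P : ℂ → ℂ → ℂ → ℂ → Prop} {C μ₀ : ℝ} (hP : GeometricBudgetOn P C μ₀)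
    (hnP : GeometricBudgetOn (fun v z Kv Kz => ¬P v z Kv Kz) C μ₀) : GeometricBudget C μ₀ := by
  intro v z Rv Rz Kv Kz u₁ u₂ M
  by_cases h : P v z Kv Kz
  · exact hP v z Rv Rz Kv Kz u₁ u₂ M h
  · exact hnP v z Rv Rz Kv Kz u₁ u₂ M h

/-- §2 the split along a side condition inside a restricted budget. -/
theorem geometricBudgetOn_of_split {P Q : ℂ → ℂ → ℂ → ℂ → Prop} {C μ₀ : ℝ} (hP : GeometricBudgetOn (fun v z Kv Kz => Q v z Kv Kz ∧ P v z Kv Kz) C μ₀)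
    (hnP : GeometricBudgetOn (fun v z Kv Kz => Q v z Kv Kz ∧ ¬P v z Kv Kz) C μ₀) : GeometricBudgetOn Q C μ₀ := by
  intro v z Rv Rz Kv Kz u₁ u₂ M hQ
  by_cases h : P v z Kv Kz
  · exact hP v z Rv Rz Kv Kz u₁ u₂ M ⟨hQ, h⟩
  · exact hnP v z Rv Rz Kv Kz u₁ u₂ M ⟨hQ, h⟩

/-- §2 CORNER CELL ∧ BULK ⇒ the budget (any width `η`). -/
theorem geometricBudget_of_corner_bulk {η C μ₀ : ℝ} (hc : GeometricBudgetOn (fun v z _ _ => CornerCell η v z) C μ₀)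
    (hb : GeometricBudgetOn (fun v z _ _ => η ≤ slack0 v z) C μ₀) : GeometricBudget C μ₀ :=
  geometricBudget_of_split hc (geometricBudgetOn_mono (fun _ _ _ _ h => not_lt.mp h) hb)

/-! ## §3 With case (A): only `t_v < 3/2` remains -/

/-- ★★ §3 **`GeometricBudget 10 μ₀` (`μ₀ ≤ 1/2`) FROM ITS RESTRICTION TO `−Im v·Im K_v < 3/2`** (the complement is image J `budget_caseA`). -/
theorem geometricBudget_ten_of_tv_lt {μ₀ : ℝ} (hμ : μ₀ ≤ 1 / 2)
    (h : GeometricBudgetOn (fun v _ Kv _ => -(v.im * Kv.im) < 3 / 2) 10 μ₀) : GeometricBudget 10 μ₀ := by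
  refine geometricBudget_of_split h ?_
  intro v z Rv Rz Kv Kz u₁ u₂ M hA hv hvz ht hsep hM0 hMμ hKv hKz _hRv hRz hR hflv _hflz hd₁ hd₂
  exact budget_caseA hμ hv hvz ht hsep hM0 hMμ hKv hKz hRz hR hflv hd₁ hd₂ (not_lt.mp hA)

/-- ★★ §3 the TWO BOXES of the certified check: (corner cell ∧ `t_v < 3/2`) and (bulk ∧ `t_v < 3/2`) ⇒ `GeometricBudget 10 μ₀` (`μ₀ ≤ 1/2`, any width `η`). -/
theorem geometricBudget_ten_of_corner_bulk_tv_lt {η μ₀ : ℝ} (hμ : μ₀ ≤ 1 / 2)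
    (hc : GeometricBudgetOn (fun v z Kv _ => -(v.im * Kv.im) < 3 / 2 ∧ CornerCell η v z) 10 μ₀)
    (hb : GeometricBudgetOn (fun v z Kv _ => -(v.im * Kv.im) < 3 / 2 ∧ η ≤ slack0 v z) 10 μ₀) : GeometricBudget 10 μ₀ :=
  geometricBudget_ten_of_tv_lt hμ
    (geometricBudgetOn_of_split (P := fun v z _ _ => CornerCell η v z) hc
      (geometricBudgetOn_mono (fun _ _ _ _ h => ⟨h.1, not_lt.mp h.2⟩) hb))

end RhW08.BudgetCornerSplit
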